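import Literature.AlgebraicGeometry.ComplexMultiplication.ShimuraIsogeny
import Literature.AlgebraicGeometry.HodgeTheory.BettiUniverseCMAction
import HarnessLib

/-!
# The inflation record read on the RATIONAL CM action (kernel consequences of `ShimuraIsogeny`)

Companion of `ShimuraIsogeny` (the universal print records `Shimura1998_Thm2_Cor`, `isogeny_bettiMap_bijective`,
`Shimura1998_Thm3_inflation` over CM-type realisations `(A, ι, θ)` read on `H¹`), joined to the tree's RATIONAL CM
action `BettiUniverse.cmAction` (G0-c, `BettiUniverseCMAction`).  PROVED (kernel, no new facts): `cmAction_eq_pull` — the rational CM action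
`BettiUniverse.cmAction θ hθ a` (G0-c) IS the pull-back `f^*` on `H¹(A(ℂ); ℚ)` along ANY `f : A → A` with
`f^* ⊗ ℂ = θ(a)`; `Shimura1998_Thm3_inflation.rational` — the record `Shimura1998_Thm3_inflation` (morphisms of
abelian varieties `p_j : A′ → A` commuting with `ι`, `⊕ p_j^*` bijective on `H¹(−, ℚ)`) yields scheme morphisms
`p_j : A′ → A` with `⊕ p_j^*` bijective and `p_j^* ∘ cmAction θ (a) = cmAction θ′ (k a) ∘ p_j^*` for ALL `a ∈ K`
(equivariance on `𝓞_K` from `ι′(k(a)) ∘ p_j = p_j ∘ ι(a)` and `θ = ι^*`, extended `ℚ`-linearly over an integral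
basis) — the exact shape of the model-construction cell's `Fact_cmInflation` (M38) before code transport.
-/

noncomputable section

open NumberField CategoryTheory Module

namespace Literature.AlgebraicGeometry.ComplexMultiplication

open Literature.AlgebraicGeometry.Motives (SchemeOver IsSmoothProjective CMType AbelianVariety bettiCohomology)
open Literature.AlgebraicGeometry.HodgeTheory (complexBetti IsOfHodgeType)
open Literature.AlgebraicGeometry.HodgeTheory.BettiUniverse (pull pull_comp cmAction cmAction_apply cmActionLin
  IsInducedOnIntegers ofRatClass_cmAction)
open Literature.AlgebraicTopology.SingularHomology
open Literature.NumberTheory.Automorphic.PicardCM (eigenline)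
open Literature.NumberTheory.ComplexMultiplication (inducedCMType)


/-- The `H¹`-action of a realisation is induced by endomorphisms on the integers (G0-c's hypothesis
`IsInducedOnIntegers`), by the clause `θ(a) = ι(a)^*`. [folklore] -/
theorem IsCMTypeRealisation.isInducedOnIntegers {K : Type} [Field K] [NumberField K] {Φ : CMType K}
    {A : AbelianVariety ℂ} {ι : 𝓞 K →+* End A} {θ : K →+* Module.End ℂ (complexBetti A.X 1)}
    (h : IsCMTypeRealisation Φ A ι θ) : IsInducedOnIntegers θ :=
  fun a ↦ ⟨(ι a).hom.hom.hom, h.2.2.1 a⟩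

/-- KERNEL: **the rational CM action is the pull-back along any inducing endomorphism.** If
`f^* ⊗ ℂ = θ(a)` on `H¹(A(ℂ); ℂ)` then `cmAction θ hθ a = f^*` on `H¹(A(ℂ); ℚ)` (both complexify to `θ(a)`
and the rational lattice `H¹(ℚ) ↪ H¹(ℂ)` is injective). [folklore] -/
theorem cmAction_eq_pull {K : Type} [Field K] [NumberField K] {A : SchemeOver ℂ}
    (θ : K →+* Module.End ℂ (complexBetti A 1)) (hθ : IsInducedOnIntegers θ) {a : K} {f : A ⟶ A}
    (hf : (complexBetti.map f 1).hom = θ a) : (cmAction θ hθ a : Module.End ℚ (bettiCohomology A 1)) = pull f 1 := by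
  apply LinearMap.ext
  intro v
  apply Literature.AlgebraicGeometry.HodgeTheory.ofRatClass_injective (Y := Motives.ComplexPoints A) 1
  rw [ofRatClass_cmAction, ← hf]
  exact (Motives.ofRatClass_map 1 (Motives.AlgPoints.mapContinuous (L := ℂ) f) v).symm

/-- KERNEL: **transport of the rational CM action along a field isomorphism** `e : K′ ≃+* K`:
`cmAction (θ ∘ e) a = cmAction θ (e a)` (both complexify to `θ(e a)`). [folklore] -/
theorem cmAction_comp_ringEquiv {K K' : Type} [Field K] [NumberField K] [Field K'] [NumberField K']
    {A : SchemeOver ℂ} (θ : K →+* Module.End ℂ (complexBetti A 1)) (hθ : IsInducedOnIntegers θ)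
    (e : K' ≃+* K) (h' : IsInducedOnIntegers (θ.comp e.toRingHom)) (a : K') :
    (cmAction (θ.comp e.toRingHom) h' a : Module.End ℚ (bettiCohomology A 1)) = cmAction θ hθ (e a) := by
  apply LinearMap.ext
  intro v
  apply Literature.AlgebraicGeometry.HodgeTheory.ofRatClass_injective (Y := Motives.ComplexPoints A) 1
  rw [ofRatClass_cmAction, ofRatClass_cmAction]
  rfl

/-- KERNEL: **the inflation record read on the rational CM actions.**  From `Shimura1998_Thm3_inflation`:
scheme morphisms `p_j : A′ → A` with `⊕_j p_j^*` bijective on `H¹(−, ℚ)` and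
`p_j^* ∘ cmAction θ (a) = cmAction θ′ (k a) ∘ p_j^*` for every `a ∈ K`. [folklore] -/
theorem Shimura1998_Thm3_inflation.rational (h38 : Shimura1998_Thm3_inflation)
    {K M : Type} [Field K] [NumberField K] [IsCMField K] [Field M] [NumberField M] [IsCMField M]
    (k : K →+* M) (Φ : CMType K)
    {A : AbelianVariety ℂ} {ι : 𝓞 K →+* End A} {θ : K →+* Module.End ℂ (complexBetti A.X 1)}
    {A' : AbelianVariety ℂ} {ι' : 𝓞 M →+* End A'} {θ' : M →+* Module.End ℂ (complexBetti A'.X 1)}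
    (h : IsCMTypeRealisation Φ A ι θ) (h' : IsCMTypeRealisation (inducedCMType k Φ) A' ι' θ')
    (hθ : IsInducedOnIntegers θ) (hθ' : IsInducedOnIntegers θ') :
    ∃ (m : ℕ) (p : Fin m → (A'.X ⟶ A.X)),
      Function.Bijective
        (∑ j : Fin m, pull (p j) 1 ∘ₗ LinearMap.proj j :
          (Fin m → bettiCohomology A.X 1) →ₗ[ℚ] bettiCohomology A'.X 1) ∧
      ∀ (j : Fin m) (a : K),
        pull (p j) 1 ∘ₗ (cmAction θ hθ a : Module.End ℚ (bettiCohomology A.X 1)) =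
          (cmAction θ' hθ' (k a) : Module.End ℚ (bettiCohomology A'.X 1)) ∘ₗ pull (p j) 1 := by
  obtain ⟨m, p, hbij, hcomm⟩ := h38 K M k Φ A ι θ A' ι' θ' h h'
  refine ⟨m, fun j ↦ (p j).hom.hom.hom, hbij, fun j ↦ ?_⟩
  -- equivariance on `𝓞_K`, from the morphism-level relation and `θ = ι^*`
  have hint : ∀ a : 𝓞 K,
      pull (p j).hom.hom.hom 1 ∘ₗ (cmAction θ hθ (a : K) : Module.End ℚ (bettiCohomology A.X 1)) =
        (cmAction θ' hθ' (k a) : Module.End ℚ (bettiCohomology A'.X 1)) ∘ₗ pull (p j).hom.hom.hom 1 := by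
    intro a
    have e₁ := cmAction_eq_pull θ hθ (h.2.2.1 a)
    have e₂ := cmAction_eq_pull θ' hθ' (h'.2.2.1 (RingOfIntegers.mapRingHom k a))
    rw [RingOfIntegers.mapRingHom_apply] at e₂
    rw [e₁, e₂, ← pull_comp, ← pull_comp]
    have hc := hcomm j a
    -- `(ι′(k a) ≫ p j).toSchemeOver = (p j ≫ ι a).toSchemeOver`
    have : (p j).hom.hom.hom ≫ (ι a).hom.hom.hom = (ι' (RingOfIntegers.mapRingHom k a)).hom.hom.hom ≫ (p j).hom.hom.hom := by
      change (p j ≫ ι a).hom.hom.hom = (ι' (RingOfIntegers.mapRingHom k a) ≫ p j).hom.hom.hom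
      rw [hc]
    rw [this]
  -- extend `ℚ`-linearly over an integral basis of `K`
  intro a
  let L₁ : K →ₗ[ℚ] (bettiCohomology A.X 1 →ₗ[ℚ] bettiCohomology A'.X 1) :=
    LinearMap.llcomp ℚ _ _ _ (pull (p j).hom.hom.hom 1) ∘ₗ (cmAction θ hθ).toLinearMap
  let L₂ : K →ₗ[ℚ] (bettiCohomology A.X 1 →ₗ[ℚ] bettiCohomology A'.X 1) :=
    (LinearMap.llcomp ℚ _ _ _).flip (pull (p j).hom.hom.hom 1) ∘ₗ ((cmAction θ' hθ').toLinearMap ∘ₗ k.toRatAlgHom.toLinearMap)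
  have hL : L₁ = L₂ := by
    refine (integralBasis K).ext fun i ↦ ?_
    simp only [L₁, L₂, LinearMap.coe_comp, Function.comp_apply, AlgHom.toLinearMap_apply,
      LinearMap.flip_apply, integralBasis_apply]
    exact hint (RingOfIntegers.basis K i)
  exact LinearMap.congr_fun hL a

end Literature.AlgebraicGeometry.ComplexMultiplication

end
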